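import Mathlib
import Literature.AlgebraicGeometry.Resolution.PointBlowupFlagInvariant
import Literature.AlgebraicGeometry.Resolution.PointBlowupHeightVectorDrops
import Literature.AlgebraicGeometry.Resolution.PointBlowupFlagShiftBound
import Summits.ResolutionOfSingularities.ResolutionOfSingularities.Theorems.WeightedInvariantLocalWeightedDropInsepNewtonMeasures
import Summits.ResolutionOfSingularities.ResolutionOfSingularities.Theorems.WeightedInvariantLocalWeightedDropInsepNewtonVMove
import Summits.ResolutionOfSingularities.ResolutionOfSingularities.Theorems.WeightedInvariantLocalWeightedDropInsepNewtonVHeight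

/-!
# `WeightedInvariant.LocalWeightedDrop`, line `hasse-ridge-face-selection`: the Newton measures under a TRIANGULAR SHEAR
# `x₀ ↦ x₀ + φ(x₁)` of the free letter (Hauser–Wagner's subordinate coordinate changes) — unit M4, first part

Crux item stmt-ResolutionOfSingularities-8899 `LocalWeightedDrop` (route `ResolutionOfSingularities/WeightedInvariant`),
serving the door `WeightedConstruction` stmt-ResolutionOfSingularities-0571.  [OURS · L1 W4.3, chain w43, stub worker 3
(gen 3): unit M4 of L/res-L1-w43-stub-3/S2iM-ATTACK-PLAN.md (key S2iM `stub_charTwoInseparableReductionWon` via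
Hauser–Wagner 2014 Thm 2 (i)); elementary support bookkeeping for the typed measures `HauserWagner2014.ordVarPS /
degAlongPS / heightPS` under the subordinate changes `y ↦ y + φ(z)`, `φ(0) = 0`, of [HW14] §4 (p. 188 l. 4–10, Rem. 4),
read through res-lit-5's series-level row formula `HauserPerlega2024.coeff_subst_triangular_row` and weight-line formula
`HauserPerlega2024.coeff_subst_triangular_of_weight_le` (Literature/…/PointBlowupFlagShiftBound.lean); NOT a statement of any
manuscript.]

Orientation: free letter `y = x₀` (slot `0`), rigid letter `z = x₁` (slot `1`); the shear is the substitution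
`θ_φ : x₀ ↦ x₀ + φ(x₁), x₁ ↦ x₁` (`φ ∈ K[[z]]`, `φ(0) = 0`), spelled as in the Literature bridge.  For `H ∈ K[[x₀, x₁]]`:
* `coeff_shear`: `[x₀^i x₁^a] θ_φ^* H = Σ_{k ≤ a} binom(i+k, i) · [z^a](φ^k · row_{i+k})` (the rows `row_j(z) = Σ_v [x₀^j x₁^v]H z^v`);
* `coeff_shear_eq_zero_of_lt` / `coeff_shear_row`: NO row below `β₁ = ord_z H` and the row `β₁` is UNCHANGED — hence
  `ordVarPS_shear_one` (`β₁` kept), `degAlongPS_shear` (`α₁ = deg_y` kept: "the highest vertex does not depend on the subordinate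
  coordinates", [HW14] p. 191 l. 24–27), `coeff_shear_vertex`;
* `coeff_shear_of_degree_lt` / `coeff_shear_initial` / `order_shear`: nothing below the order `d = ord H`, the order is kept, and ON
  the initial line `i + a = d` the sheared coefficient is the Taylor coefficient `[Y^i] f(Y + t)` of the dehomogenised initial
  form `f(Y) = Σ_b [x₀^b x₁^{d−b}]H · Y^b` at `t = [z¹]φ` — only the LINEAR part of `φ` acts on the initial form (this is where
  [HW14] Lemma 2/3 = Moh's bound enters, next file).
-/

set_option linter.dupNamespace false -- mandated namespace of this single-conjunct summit

namespace Summit.ResolutionOfSingularities.ResolutionOfSingularities.Theorems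

namespace InsepNewton

open MvPowerSeries
open Literature.AlgebraicGeometry.Resolution
open Literature.AlgebraicGeometry.Resolution.HauserPerlega2024 (ordAlong)
open Literature.AlgebraicGeometry.Resolution.HauserWagner2014 (ordVarPS degAlongPS heightPS)

variable {K : Type} [Field K]

/-! ### The shear `θ_φ : x₀ ↦ x₀ + φ(x₁), x₁ ↦ x₁` -/

/-- The shear has zero constant terms (`φ(0) = 0`). -/
theorem constantCoeff_shear {φ : PowerSeries K} (hφ : PowerSeries.constantCoeff φ = 0) (l : Fin 2) :
    constantCoeff ((fun l : Fin 2 => if l = 0 then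
      (X 0 : MvPowerSeries (Fin 2) K) + PowerSeries.subst (X 1 : MvPowerSeries (Fin 2) K) φ else X l) l) = 0 := by
  rcases (by fin_cases l <;> simp : l = 0 ∨ l = 1) with rfl | rfl
  · simp only [↓reduceIte, map_add, constantCoeff_X, zero_add]
    exact PowerSeries.constantCoeff_subst_eq_zero (constantCoeff_X 1) φ hφ
  · simp [constantCoeff_X]

/-- The shear is substitutable. -/
theorem hasSubst_shear {φ : PowerSeries K} (hφ : PowerSeries.constantCoeff φ = 0) :
    HasSubst (fun l : Fin 2 => if l = 0 then
      (X 0 : MvPowerSeries (Fin 2) K) + PowerSeries.subst (X 1 : MvPowerSeries (Fin 2) K) φ else X l) :=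
  hasSubst_of_constantCoeff_zero (constantCoeff_shear hφ)

/-- Respelling a two-letter exponent through its two values (equation form used for rewriting supports). -/
theorem coeff_single_add_single_eq (d : Fin 2 →₀ ℕ) : Finsupp.single (0 : Fin 2) (d 0) + Finsupp.single 1 (d 1) = d := by
  ext l
  rcases (by fin_cases l <;> simp : l = 0 ∨ l = 1) with rfl | rfl <;> simp

/-- **THE ROWS OF A SHEARED SERIES** (res-lit-5's `coeff_subst_triangular_row` at `r = 0`, in this file's spelling):
`[x₀^i x₁^a] θ_φ^* H = Σ_{k ≤ a} binom(i+k, i) · [z^a](φ^k · row_{i+k})`, `row_j = Σ_v [x₀^j x₁^v]H · z^v`.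
[cite: HauserWagner2014, §4 p. 188 l. 4–10 (subordinate changes)] -/
theorem coeff_shear {φ : PowerSeries K} (hφ : PowerSeries.constantCoeff φ = 0) (H : MvPowerSeries (Fin 2) K)
    (i a : ℕ) :
    coeff (Finsupp.single 0 i + Finsupp.single 1 a) (subst (fun l : Fin 2 => if l = 0 then
      (X 0 : MvPowerSeries (Fin 2) K) + PowerSeries.subst (X 1 : MvPowerSeries (Fin 2) K) φ else X l) H) =
      ∑ k ∈ Finset.range (a + 1), (((i + k).choose i : ℕ) : K) *
        PowerSeries.coeff a (φ ^ k * PowerSeries.mk fun v => coeff (Finsupp.single 0 (i + k) + Finsupp.single 1 v) H) := by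
  have h := HauserPerlega2024.coeff_subst_triangular_row (1 : Fin 2) 0 one_ne_zero
    (fun l => (eq_or_eq_of_ne (show (1 : Fin 2) ≠ 0 from one_ne_zero) l).symm) φ hφ H 0
    (fun _ _ => Nat.zero_le _) (fun j => PowerSeries.mk fun v => coeff (Finsupp.single 0 j + Finsupp.single 1 v) H)
    (fun j v => by rw [PowerSeries.coeff_mk, zero_add, add_comm]) i a
  rw [zero_add, add_comm (Finsupp.single (1 : Fin 2) a)] at h
  exact h

/-- A coefficient of `φ^k · row` below `n` only sees the row below `n`: if the row vanishes below `n`, so does the product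
(`a < n`). -/
theorem coeff_pow_mul_eq_zero_of_lt {φ row : PowerSeries K} {n a : ℕ} (hrow : ∀ v < n, PowerSeries.coeff v row = 0)
    (ha : a < n) (k : ℕ) : PowerSeries.coeff a (φ ^ k * row) = 0 := by
  rw [PowerSeries.coeff_mul]
  refine Finset.sum_eq_zero fun uv huv => ?_
  rw [Finset.HasAntidiagonal.mem_antidiagonal] at huv
  rw [hrow uv.2 (by omega), mul_zero]

/-- At level `n` exactly, `φ^k · row` with `k ≥ 1` still vanishes if the row vanishes below `n` (`φ(0) = 0` kills the term
`[z⁰]φ^k · [zⁿ]row`). -/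
theorem coeff_pow_succ_mul_eq_zero {φ row : PowerSeries K} (hφ : PowerSeries.constantCoeff φ = 0) {n : ℕ}
    (hrow : ∀ v < n, PowerSeries.coeff v row = 0) (k : ℕ) : PowerSeries.coeff n (φ ^ (k + 1) * row) = 0 := by
  rw [PowerSeries.coeff_mul]
  refine Finset.sum_eq_zero fun uv huv => ?_
  rw [Finset.HasAntidiagonal.mem_antidiagonal] at huv
  rcases Nat.eq_zero_or_pos uv.1 with hu | hu
  · rw [hu, PowerSeries.coeff_zero_eq_constantCoeff, map_pow, hφ, zero_pow (Nat.succ_ne_zero k), zero_mul]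
  · rw [hrow uv.2 (by omega), mul_zero]

/-- The rows of `H` vanish below `β₁ = ord_z H`. -/
theorem coeff_row_eq_zero_of_lt (H : MvPowerSeries (Fin 2) K) (j : ℕ) {v : ℕ} (hv : v < ordVarPS H 1) :
    PowerSeries.coeff v (PowerSeries.mk fun v => coeff (Finsupp.single 0 j + Finsupp.single 1 v) H) = 0 := by
  rw [PowerSeries.coeff_mk]
  by_contra h
  have := ordVarPS_le 1 h
  rw [pair_apply_one] at this
  omega

/-- **NO ROW BELOW `β₁`**: `[x₀^i x₁^a] θ_φ^* H = 0` for `a < ord_z H`. -/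
theorem coeff_shear_eq_zero_of_lt {φ : PowerSeries K} (hφ : PowerSeries.constantCoeff φ = 0) (H : MvPowerSeries (Fin 2) K)
    (i : ℕ) {a : ℕ} (ha : a < ordVarPS H 1) :
    coeff (Finsupp.single 0 i + Finsupp.single 1 a) (subst (fun l : Fin 2 => if l = 0 then
      (X 0 : MvPowerSeries (Fin 2) K) + PowerSeries.subst (X 1 : MvPowerSeries (Fin 2) K) φ else X l) H) = 0 := by
  rw [coeff_shear hφ]
  refine Finset.sum_eq_zero fun k _ => ?_
  rw [coeff_pow_mul_eq_zero_of_lt (fun v hv => coeff_row_eq_zero_of_lt H (i + k) hv) ha k, mul_zero]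

/-- **THE ROW `β₁` IS UNCHANGED**: `[x₀^i x₁^{β₁}] θ_φ^* H = [x₀^i x₁^{β₁}] H`. [cite: HauserWagner2014, §4 p. 191 l. 24–27] -/
theorem coeff_shear_row {φ : PowerSeries K} (hφ : PowerSeries.constantCoeff φ = 0) (H : MvPowerSeries (Fin 2) K) (i : ℕ) :
    coeff (Finsupp.single 0 i + Finsupp.single 1 (ordVarPS H 1)) (subst (fun l : Fin 2 => if l = 0 then
      (X 0 : MvPowerSeries (Fin 2) K) + PowerSeries.subst (X 1 : MvPowerSeries (Fin 2) K) φ else X l) H) =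
      coeff (Finsupp.single 0 i + Finsupp.single 1 (ordVarPS H 1)) H := by
  rw [coeff_shear hφ, Finset.sum_range_succ', Finset.sum_eq_zero, zero_add]
  · rw [add_zero, Nat.choose_self, Nat.cast_one, one_mul, pow_zero, one_mul, PowerSeries.coeff_mk]
  · intro k _
    rw [coeff_pow_succ_mul_eq_zero hφ (fun v hv => coeff_row_eq_zero_of_lt H _ hv) k, mul_zero]

/-- In particular THE HIGHEST VERTEX `(α₁, β₁)` KEEPS ITS COEFFICIENT. -/
theorem coeff_shear_vertex {φ : PowerSeries K} (hφ : PowerSeries.constantCoeff φ = 0) (H : MvPowerSeries (Fin 2) K) :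
    coeff (Finsupp.single 0 (degAlongPS H 1 0) + Finsupp.single 1 (ordVarPS H 1)) (subst (fun l : Fin 2 => if l = 0 then
      (X 0 : MvPowerSeries (Fin 2) K) + PowerSeries.subst (X 1 : MvPowerSeries (Fin 2) K) φ else X l) H) =
      coeff (Finsupp.single 0 (degAlongPS H 1 0) + Finsupp.single 1 (ordVarPS H 1)) H :=
  coeff_shear_row hφ H _

/-- The highest vertex of a non-zero `H` has non-zero coefficient (respelled with `pair`). -/
theorem coeff_vertex_ne_zero {H : MvPowerSeries (Fin 2) K} (hH : H ≠ 0) :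
    coeff (Finsupp.single 0 (degAlongPS H 1 0) + Finsupp.single 1 (ordVarPS H 1)) H ≠ 0 := by
  obtain ⟨d, hd, hd1, hd0⟩ := exists_vertex hH 1 0
  rw [(coeff_single_add_single_eq d).symm, hd0, hd1] at hd
  exact hd

/-- A sheared non-zero series is non-zero. -/
theorem shear_ne_zero {φ : PowerSeries K} (hφ : PowerSeries.constantCoeff φ = 0) {H : MvPowerSeries (Fin 2) K} (hH : H ≠ 0) :
    subst (fun l : Fin 2 => if l = 0 then
      (X 0 : MvPowerSeries (Fin 2) K) + PowerSeries.subst (X 1 : MvPowerSeries (Fin 2) K) φ else X l) H ≠ 0 := by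
  intro h
  have := coeff_shear_vertex hφ H
  rw [h, map_zero] at this
  exact coeff_vertex_ne_zero hH this.symm

/-- **`β₁` IS KEPT**: `ord_z (θ_φ^* H) = ord_z H` (`H ≠ 0`). -/
theorem ordVarPS_shear_one {φ : PowerSeries K} (hφ : PowerSeries.constantCoeff φ = 0) {H : MvPowerSeries (Fin 2) K}
    (hH : H ≠ 0) :
    ordVarPS (subst (fun l : Fin 2 => if l = 0 then
      (X 0 : MvPowerSeries (Fin 2) K) + PowerSeries.subst (X 1 : MvPowerSeries (Fin 2) K) φ else X l) H) 1 = ordVarPS H 1 := by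
  refine le_antisymm ?_ ?_
  · have h := coeff_shear_vertex hφ H
    have hne : coeff (Finsupp.single 0 (degAlongPS H 1 0) + Finsupp.single 1 (ordVarPS H 1)) (subst (fun l : Fin 2 =>
        if l = 0 then (X 0 : MvPowerSeries (Fin 2) K) + PowerSeries.subst (X 1 : MvPowerSeries (Fin 2) K) φ else X l) H) ≠ 0 := by
      rw [h]; exact coeff_vertex_ne_zero hH
    have := ordVarPS_le 1 hne
    rwa [pair_apply_one] at this
  · obtain ⟨e, he', he1⟩ := exists_coeff_apply_eq_ordVarPS 1 (shear_ne_zero hφ hH)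
    have he := coeff_single_add_single_ne_zero he'
    rw [← he1]
    by_contra hlt
    exact he (coeff_shear_eq_zero_of_lt hφ H (e 0) (not_le.mp hlt))

/-- **`α₁` IS KEPT**: `deg_y (θ_φ^* H) = deg_y H` — the highest vertex does not depend on the subordinate coordinates (`H ≠ 0`).
[cite: HauserWagner2014, §4 p. 191 l. 24–27] -/
theorem degAlongPS_shear {φ : PowerSeries K} (hφ : PowerSeries.constantCoeff φ = 0) {H : MvPowerSeries (Fin 2) K}
    (hH : H ≠ 0) :
    degAlongPS (subst (fun l : Fin 2 => if l = 0 then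
      (X 0 : MvPowerSeries (Fin 2) K) + PowerSeries.subst (X 1 : MvPowerSeries (Fin 2) K) φ else X l) H) 1 0 =
      degAlongPS H 1 0 := by
  have hβ := ordVarPS_shear_one hφ hH
  refine le_antisymm ?_ ?_
  · have h := coeff_shear_vertex hφ H
    have hne : coeff (Finsupp.single 0 (degAlongPS H 1 0) + Finsupp.single 1 (ordVarPS H 1)) (subst (fun l : Fin 2 =>
        if l = 0 then (X 0 : MvPowerSeries (Fin 2) K) + PowerSeries.subst (X 1 : MvPowerSeries (Fin 2) K) φ else X l) H) ≠ 0 := by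
      rw [h]; exact coeff_vertex_ne_zero hH
    have := degAlongPS_le (rig := 1) (free := 0) hne (by rw [pair_apply_one, hβ])
    rwa [pair_apply_zero] at this
  · refine le_degAlongPS (shear_ne_zero hφ hH) fun e he' he1 => ?_
    have he := coeff_single_add_single_ne_zero he'
    rw [hβ] at he1
    rw [he1, coeff_shear_row hφ H] at he
    have := degAlongPS_le (rig := 1) (free := 0) he (by rw [pair_apply_one])
    rwa [pair_apply_zero] at this

/-! ### The initial form under the shear: nothing below the order, Taylor on the initial line -/

/-- Every support point of `H` has degree `≥ ord H` (the weight hypothesis of the Literature weight-line formula at `n = 1`). -/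
theorem order_toNat_le_of_coeff_ne_zero {H : MvPowerSeries (Fin 2) K} {d : Fin 2 →₀ ℕ} (hd : coeff d H ≠ 0) :
    H.order.toNat ≤ d 1 + 1 * d 0 := by
  have h := order_le hd
  rw [(coeff_single_add_single_eq d).symm, degree_pair] at h
  have hfin : H.order ≠ ⊤ := ne_top_of_le_ne_top (ENat.coe_ne_top _) h
  have h' := h
  rw [← ENat.coe_toNat hfin] at h'
  have : H.order.toNat ≤ d 0 + d 1 := by exact_mod_cast h'
  omega

/-- **THE SHEAR ON AND BELOW THE INITIAL LINE** (res-lit-5's `coeff_subst_triangular_of_weight_le` at `n = 1`, `w₀ = d = ord H`):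
for `i + a ≤ d`, `[x₀^i x₁^a] θ_φ^* H` is `0` if `i + a < d` and, if `i + a = d`, the Taylor coefficient `[Y^i] f(Y + t)` of the
dehomogenised initial form `f = Σ_{b ≤ d} [x₀^b x₁^{d−b}]H · Y^b` at `t = [z¹]φ`. [cite: HauserWagner2014, §6.1 Lemma 3 proof p. 203] -/
theorem coeff_shear_of_degree_le {φ : PowerSeries K} (hφ : PowerSeries.constantCoeff φ = 0) (H : MvPowerSeries (Fin 2) K)
    {d : ℕ} (hd : H.order.toNat = d) {i a : ℕ} (hia : i + a ≤ d) :
    coeff (Finsupp.single 0 i + Finsupp.single 1 a) (subst (fun l : Fin 2 => if l = 0 then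
      (X 0 : MvPowerSeries (Fin 2) K) + PowerSeries.subst (X 1 : MvPowerSeries (Fin 2) K) φ else X l) H) =
      if i + a = d then (Polynomial.taylor (PowerSeries.coeff 1 φ) (∑ b ∈ Finset.range (d + 1),
        Polynomial.monomial b (coeff (Finsupp.single 0 b + Finsupp.single 1 (d - b)) H))).coeff i else 0 := by
  have hlt : ∀ m, m < 1 → PowerSeries.coeff m φ = 0 := fun m hm => by
    rw [Nat.lt_one_iff.mp hm, PowerSeries.coeff_zero_eq_constantCoeff_apply]; exact hφ
  have hw : ∀ e : Fin 2 →₀ ℕ, coeff e H ≠ 0 → d ≤ e 1 + 1 * e 0 := fun e he => by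
    rw [← hd]; exact order_toNat_le_of_coeff_ne_zero he
  have h := HauserPerlega2024.coeff_subst_triangular_of_weight_le (1 : Fin 2) 0 one_ne_zero
    (fun l => (eq_or_eq_of_ne (show (1 : Fin 2) ≠ 0 from one_ne_zero) l).symm)
    (t := PowerSeries.coeff 1 φ) one_pos hlt rfl H hw (Finsupp.single 0 i + Finsupp.single 1 a)
    (by rw [pair_apply_one, pair_apply_zero]; omega)
  rw [pair_apply_one, pair_apply_zero, one_mul, Nat.div_one] at h
  have hsum : (∑ b ∈ Finset.range (d + 1), Polynomial.monomial b
      (coeff (Finsupp.single (1 : Fin 2) (d - 1 * b) + Finsupp.single 0 b) H)) =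
      ∑ b ∈ Finset.range (d + 1), Polynomial.monomial b (coeff (Finsupp.single 0 b + Finsupp.single 1 (d - b)) H) :=
    Finset.sum_congr rfl fun b _ => by rw [one_mul, add_comm (Finsupp.single (1 : Fin 2) (d - b))]
  rw [h, hsum]
  by_cases hia' : i + a = d
  · rw [if_pos (by omega), if_pos hia']
  · rw [if_neg (by omega), if_neg hia']

/-- **NOTHING BELOW THE ORDER**: `[x₀^i x₁^a] θ_φ^* H = 0` for `i + a < ord H`. -/
theorem coeff_shear_of_degree_lt {φ : PowerSeries K} (hφ : PowerSeries.constantCoeff φ = 0) (H : MvPowerSeries (Fin 2) K)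
    {i a : ℕ} (hia : i + a < H.order.toNat) :
    coeff (Finsupp.single 0 i + Finsupp.single 1 a) (subst (fun l : Fin 2 => if l = 0 then
      (X 0 : MvPowerSeries (Fin 2) K) + PowerSeries.subst (X 1 : MvPowerSeries (Fin 2) K) φ else X l) H) = 0 := by
  rw [coeff_shear_of_degree_le hφ H rfl hia.le, if_neg hia.ne]

/-- **THE INITIAL FORM IS SHEARED LINEARLY**: on the initial line `i + a = ord H` the coefficient of `θ_φ^* H` is the Taylor
coefficient `[Y^i] f(Y + [z¹]φ)` of the dehomogenised initial form. [cite: HauserWagner2014, §6.1 Lemma 3 proof p. 203 ("`F* = z^d·Σ_j c′_j y^j + …`")] -/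
theorem coeff_shear_initial {φ : PowerSeries K} (hφ : PowerSeries.constantCoeff φ = 0) (H : MvPowerSeries (Fin 2) K)
    {d : ℕ} (hd : H.order.toNat = d) {i a : ℕ} (hia : i + a = d) :
    coeff (Finsupp.single 0 i + Finsupp.single 1 a) (subst (fun l : Fin 2 => if l = 0 then
      (X 0 : MvPowerSeries (Fin 2) K) + PowerSeries.subst (X 1 : MvPowerSeries (Fin 2) K) φ else X l) H) =
      (Polynomial.taylor (PowerSeries.coeff 1 φ) (∑ b ∈ Finset.range (d + 1),
        Polynomial.monomial b (coeff (Finsupp.single 0 b + Finsupp.single 1 (d - b)) H))).coeff i := by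
  rw [coeff_shear_of_degree_le hφ H hd hia.le, if_pos hia]

/-- The dehomogenised initial form of a non-zero `H` is a non-zero polynomial. -/
theorem initialPoly_ne_zero {H : MvPowerSeries (Fin 2) K} (hH : H ≠ 0) {d : ℕ} (hd : H.order.toNat = d) :
    (∑ b ∈ Finset.range (d + 1), Polynomial.monomial b (coeff (Finsupp.single 0 b + Finsupp.single 1 (d - b)) H)) ≠ 0 := by
  obtain ⟨e, he', hdeg⟩ := exists_coeff_ne_zero_and_order ((ne_zero_iff_order_finite (f := H)).mp hH)
  have he := coeff_single_add_single_ne_zero he'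
  have hsum : e 0 + e 1 = d := by
    have h1 : (e.degree : ℕ∞) = ((e 0 + e 1 : ℕ) : ℕ∞) := by
      conv_lhs => rw [(coeff_single_add_single_eq e).symm]
      rw [degree_pair]
    rw [h1] at hdeg
    have h2 := congrArg ENat.toNat hdeg
    rw [ENat.toNat_coe, hd] at h2
    exact h2
  intro h0
  have h := congrArg (fun p : Polynomial K => p.coeff (e 0)) h0
  simp only [Polynomial.finsetSum_coeff, Polynomial.coeff_monomial, Polynomial.coeff_zero] at h
  rw [Finset.sum_eq_single (e 0), if_pos rfl, show d - e 0 = e 1 by omega] at h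
  · exact he h
  · intro b _ hb; rw [if_neg hb]
  · intro hn; exfalso; exact hn (Finset.mem_range.mpr (by omega))

/-- The dehomogenised initial form has degree `≤ d`. -/
theorem natDegree_initialPoly_le (H : MvPowerSeries (Fin 2) K) (d : ℕ) :
    (∑ b ∈ Finset.range (d + 1), Polynomial.monomial b (coeff (Finsupp.single 0 b + Finsupp.single 1 (d - b)) H)).natDegree
      ≤ d := by
  refine Polynomial.natDegree_sum_le_of_forall_le _ _ fun b hb => ?_
  exact (Polynomial.natDegree_monomial_le _).trans (by have := Finset.mem_range.mp hb; omega)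

/-- **THE ORDER IS KEPT**: `ord (θ_φ^* H) = ord H`. -/
theorem order_shear {φ : PowerSeries K} (hφ : PowerSeries.constantCoeff φ = 0) (H : MvPowerSeries (Fin 2) K) :
    (subst (fun l : Fin 2 => if l = 0 then
      (X 0 : MvPowerSeries (Fin 2) K) + PowerSeries.subst (X 1 : MvPowerSeries (Fin 2) K) φ else X l) H).order = H.order := by
  by_cases hH : H = 0
  · subst hH
    rw [← coe_substAlgHom (hasSubst_shear hφ), map_zero]
  set d := H.order.toNat with hd
  have hdH : H.order = d := (ENat.coe_toNat (fun h => hH (order_eq_top_iff.mp h))).symm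
  refine le_antisymm ?_ ?_
  · -- some Taylor coefficient on the initial line is non-zero
    set f := ∑ b ∈ Finset.range (d + 1), Polynomial.monomial b (coeff (Finsupp.single 0 b + Finsupp.single 1 (d - b)) H)
      with hf
    have hf0 : Polynomial.taylor (PowerSeries.coeff 1 φ) f ≠ 0 := by
      rw [Ne, Polynomial.taylor_eq_zero]; exact initialPoly_ne_zero hH rfl
    obtain ⟨i, hi⟩ : ∃ i, (Polynomial.taylor (PowerSeries.coeff 1 φ) f).coeff i ≠ 0 := by
      by_contra h
      push Not at h
      exact hf0 (Polynomial.ext fun i => by rw [h i, Polynomial.coeff_zero])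
    have hid : i ≤ d := by
      have h1 := Polynomial.le_natDegree_of_ne_zero hi
      rw [Polynomial.natDegree_taylor] at h1
      exact h1.trans (natDegree_initialPoly_le H d)
    have hc : coeff (Finsupp.single 0 i + Finsupp.single 1 (d - i)) (subst (fun l : Fin 2 => if l = 0 then
        (X 0 : MvPowerSeries (Fin 2) K) + PowerSeries.subst (X 1 : MvPowerSeries (Fin 2) K) φ else X l) H) ≠ 0 := by
      rw [coeff_shear_initial hφ H rfl (show i + (d - i) = d by omega)]
      exact hi
    refine (order_le hc).trans ?_
    rw [degree_pair, hdH]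
    exact_mod_cast (by omega : i + (d - i) ≤ d)
  · refine le_order fun e he => ?_
    rw [(coeff_single_add_single_eq e).symm]
    apply coeff_shear_of_degree_lt hφ H
    rw [(coeff_single_add_single_eq e).symm, degree_pair, hdH] at he
    rw [← hd]
    exact_mod_cast he

/-- … and so is every lower bound on it (the form used by the lift: `2 ≤ ord`). -/
theorem le_order_shear {φ : PowerSeries K} (hφ : PowerSeries.constantCoeff φ = 0) {H : MvPowerSeries (Fin 2) K} {n : ℕ∞}
    (h : n ≤ H.order) :
    n ≤ (subst (fun l : Fin 2 => if l = 0 then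
      (X 0 : MvPowerSeries (Fin 2) K) + PowerSeries.subst (X 1 : MvPowerSeries (Fin 2) K) φ else X l) H).order := by
  rw [order_shear hφ]; exact h

end InsepNewton

end Summit.ResolutionOfSingularities.ResolutionOfSingularities.Theorems
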